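import Summits.QuantumAdvantage.AdviceFreeQNC0.WalkGapNaming
import Summits.QuantumAdvantage.AdviceFreeQNC0.EliminationHardnessF
import HarnessLib

/-!
# Cell qa-qnc0 (odd primes `p ≥ 5`): rung R3 `WalkHardFGap p` from LEVEL-SET ELIMINATION — the fibre argument

Planner qa-qnc0-p2 g13, ROUND-13 §2/§4 (statement `WalkHardFGap p` in `SparseOfGap.lean`, verbatim).  PROVED here:

* **`walkHardFGap_of_elimLevel p`** — if `𝔽_p`-low-degree LEVEL SETS cannot eliminate `|u| mod 3` at degree
  `c₀√n` (the shape of qn-prover g10's `elimLevelSqrtF p` for `p ≠ 3`, `EliminationHardnessF.lean`, taken here as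
  the hypothesis `hE` so that this file does not wait for that module), then `WalkHardFGap p`: a polylog-degree
  `𝔽_p` strategy with `s` potentially-active cuts and a cut-free bit interval of length `L ≥ s²(log₂ n)^{2C+2}`
  wins α's walk game on at most `θ·2ⁿ`, `θ = max(1 − η₀, 1/2) < 1`.
  Proof (ROUND-13 §4): in each fibre `z ↦ ow u z` the win bit is `F(Y(z), wt z)` (`ringWinU_ow`); the named
  residue `e_u(z) = R(Y(z))` loses (`exists_losing_residue`), its level sets have degree `≤ s·(log₂ n)^C ≤ c₀√L`
  (`namedRes_levelSet_mem_lowDeg`; budget `s·D·log₂ n ≤ √L`, `c₀·log₂ n ≥ 1`), so `hE` on the `L`-cube gives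
  `≥ η₀·2^L` hits = losses per fibre, and `sum_fibre` adds them up to `≥ η₀·2ⁿ`.  No active cut at all ⇒ no win.

With `sparseOfGap` (`SparseOfGap.lean`): `hE → WalkHardFSparse p` (`walkHardFSparse_of_elimLevel`), and, over
qn-prover g10's `elimLevelSqrtF` (`EliminationHardnessF.lean`), the UNCONDITIONAL rungs for every prime `p ≠ 3`:
**`walkHardFGap (p) (hp3 : p ≠ 3) : WalkHardFGap p`** (R3) and **`walkHardFSparse (p) (hp3 : p ≠ 3) : WalkHardFSparse p`**
(R4: polylog-degree `𝔽_p` strategies with `s` potentially-active cuts, `s³(log₂ n)^{2C+3} ≤ n`, ANY geometry, lose α's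
walk game on `≥ (1−θ)·2ⁿ` inputs; R2 `WalkHardFAnchored p` follows by `walkHardFAnchored_of_sparse`).  WHAT THIS IS NOT: nothing on the DENSE non-local crux `WalkHardF p` (ROUND-13 §3); `p = 3` is
excluded in substance (`walkEasyThree` is 2-sparse with a gap, so `WalkHardFGap 3` is false and `hE` fails at
`p = 3`); separation NOT moved.
-/

noncomputable section

namespace Summit.QuantumAdvantage.AdviceFreeQNC0

open Classical
open Finset
open Literature.Computability.MetaComplexity Literature.Computability.MetaComplexity.Smolensky

variable {n : ℕ}

open GapFibre in
/-- **R3 from level-set elimination** (the fibre argument): the `elimLevelSqrtF`-shape hypothesis `hE` gives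
`WalkHardFGap p` with `θ = max (1 − η₀) (1/2)`. -/
theorem walkHardFGap_of_elimLevel (p : ℕ) [Fact p.Prime]
    (hE : ∃ η₀ : ℝ, 0 < η₀ ∧ ∃ c₀ : ℝ, 0 < c₀ ∧ ∃ n₀ : ℕ, ∀ n ≥ n₀, ∀ d : ℕ, (d : ℝ) ≤ c₀ * Real.sqrt n →
      ∀ e : (Fin n → Bool) → ℕ,
        (∀ r : ℕ, (fun u => if e u % 3 = r % 3 then (1 : ZMod p) else 0) ∈
          Smolensky.lowDeg (ZMod p) n d) →
        η₀ * (2 : ℝ) ^ n ≤ ((Finset.univ.filter fun u : Fin n → Bool =>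
          e u % 3 = Hegedus.wt u % 3).card : ℝ)) :
    WalkHardFGap p := by
  obtain ⟨η₀, hη₀, c₀, hc₀, n₁, H⟩ := hE
  refine ⟨max (1 - η₀) (1 / 2), max_lt (by linarith) (by norm_num), fun C => ?_⟩
  obtain ⟨K, hK⟩ : ∃ K : ℕ, K = max 2 (max (⌈1 / c₀⌉₊) n₁) := ⟨_, rfl⟩
  refine ⟨2 ^ K, fun n hn c i L y hdeg hcf hiL hbud => ?_⟩
  have hθ : 1 - η₀ ≤ max (1 - η₀) (1 / 2) := le_max_left _ _
  have hθ' : (1 : ℝ) / 2 ≤ max (1 - η₀) (1 / 2) := le_max_right _ _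
  have h2n : (0 : ℝ) < (2 : ℝ) ^ n := by positivity
  have hlogK : K ≤ Nat.log 2 n := Nat.le_log_of_pow_le (by norm_num) hn
  have hlog2 : 2 ≤ Nat.log 2 n := le_trans (by rw [hK]; exact le_max_left _ _) hlogK
  have hlogn₁ : n₁ ≤ Nat.log 2 n :=
    le_trans (by rw [hK]; exact le_trans (le_max_right _ _) (le_max_right _ _)) hlogK
  have hlogc : 1 / c₀ ≤ (Nat.log 2 n : ℝ) := by
    have h1 : (⌈1 / c₀⌉₊ : ℕ) ≤ Nat.log 2 n :=
      le_trans (by rw [hK]; exact le_trans (le_max_left _ _) (le_max_right _ _)) hlogK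
    exact le_trans (Nat.le_ceil _) (by exact_mod_cast h1)
  -- the win and loss sets
  have htot : ((univ.filter fun u : Fin n → Bool => ringWinU c y u = true).card : ℝ) +
      ((univ.filter fun u : Fin n → Bool => ringWinU c y u = false).card : ℝ) = (2 : ℝ) ^ n := by
    have h := Finset.card_filter_add_card_filter_not (s := (univ : Finset (Fin n → Bool)))
      (fun u : Fin n → Bool => ringWinU c y u = true)
    have hneg : (univ.filter fun u : Fin n → Bool => ¬ ringWinU c y u = true) =
        univ.filter fun u : Fin n → Bool => ringWinU c y u = false :=
      Finset.filter_congr fun u _ => by simp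
    rw [hneg, card_univ, Fintype.card_fun, Fintype.card_bool, Fintype.card_fin] at h
    exact_mod_cast h
  by_cases hs : (activeCuts y).card = 0
  · -- no potentially-active cut: nobody ever wins
    have hempty : activeCuts y = ∅ := Finset.card_eq_zero.1 hs
    have hnone : ∀ u : Fin n → Bool, ringWinU c y u = false := by
      intro u
      unfold ringWinU
      rw [decide_eq_false_iff_not]
      have h0 : (univ.filter fun g : Fin (n + 1) =>
          y g u = true ∧ (c + g.val + walkExp u g.val) % 3 ≠ 0) = ∅ := by
        rw [Finset.eq_empty_iff_forall_notMem]
        intro g hg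
        rw [mem_filter] at hg
        have : g ∈ activeCuts y := by
          unfold activeCuts; rw [mem_filter]; exact ⟨mem_univ _, u, hg.2.1⟩
        rw [hempty] at this
        exact Finset.notMem_empty g this
      rw [h0, card_empty]
      omega
    have hwin0 : (univ.filter fun u : Fin n → Bool => ringWinU c y u = true).card = 0 := by
      rw [Finset.card_eq_zero, Finset.eq_empty_iff_forall_notMem]
      intro u hu
      rw [mem_filter, hnone u] at hu
      exact Bool.false_ne_true hu.2
    rw [hwin0]
    push_cast
    nlinarith
  · -- `s ≥ 1` potentially-active cuts
    have hs1 : 1 ≤ (activeCuts y).card := Nat.one_le_iff_ne_zero.2 hs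
    have hL1 : (Nat.log 2 n) ^ (2 * C + 2) ≤ L := by
      refine le_trans ?_ hbud
      calc (Nat.log 2 n) ^ (2 * C + 2) = 1 * (Nat.log 2 n) ^ (2 * C + 2) := (one_mul _).symm
        _ ≤ (activeCuts y).card ^ 2 * (Nat.log 2 n) ^ (2 * C + 2) :=
            Nat.mul_le_mul_right _ (Nat.one_le_pow _ _ hs1)
    have hLn₁ : n₁ ≤ L := by
      refine le_trans hlogn₁ (le_trans ?_ hL1)
      calc Nat.log 2 n = (Nat.log 2 n) ^ 1 := (pow_one _).symm
        _ ≤ (Nat.log 2 n) ^ (2 * C + 2) := Nat.pow_le_pow_right (by omega) (by omega)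
    -- the degree budget `s·D ≤ c₀ √L`
    have hd : (((activeCuts y).card * (Nat.log 2 n) ^ C : ℕ) : ℝ) ≤ c₀ * Real.sqrt L := by
      have h1 : ((activeCuts y).card * (Nat.log 2 n) ^ C * Nat.log 2 n) ^ 2 ≤ L := by
        calc ((activeCuts y).card * (Nat.log 2 n) ^ C * Nat.log 2 n) ^ 2
            = (activeCuts y).card ^ 2 * (Nat.log 2 n) ^ (2 * C + 2) := by ring
          _ ≤ L := hbud
      have h2 : (((activeCuts y).card * (Nat.log 2 n) ^ C : ℕ) : ℝ) * (Nat.log 2 n : ℝ) ≤ Real.sqrt L := by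
        rw [Real.le_sqrt (by positivity) (by positivity)]
        exact_mod_cast h1
      have h3 : (1 : ℝ) ≤ c₀ * (Nat.log 2 n : ℝ) := by
        rw [div_le_iff₀ hc₀] at hlogc
        linarith
      calc (((activeCuts y).card * (Nat.log 2 n) ^ C : ℕ) : ℝ)
          = (((activeCuts y).card * (Nat.log 2 n) ^ C : ℕ) : ℝ) * 1 := (mul_one _).symm
        _ ≤ (((activeCuts y).card * (Nat.log 2 n) ^ C : ℕ) : ℝ) * (c₀ * (Nat.log 2 n : ℝ)) :=
            mul_le_mul_of_nonneg_left h3 (by positivity)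
        _ = c₀ * ((((activeCuts y).card * (Nat.log 2 n) ^ C : ℕ) : ℝ) * (Nat.log 2 n : ℝ)) := by ring
        _ ≤ c₀ * Real.sqrt L := mul_le_mul_of_nonneg_left h2 hc₀.le
    -- every fibre has `≥ η₀·2^L` losses
    have hfibre : ∀ u : Fin n → Bool, η₀ * (2 : ℝ) ^ L ≤
        ((univ.filter fun z : Fin L → Bool => ringWinU c y (ow i L u z) = false).card : ℝ) := by
      intro u
      have hH := H L hLn₁ ((activeCuts y).card * (Nat.log 2 n) ^ C) hd (namedRes i L c y u)
        (fun r => namedRes_levelSet_mem_lowDeg y hdeg u r)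
      refine le_trans hH ?_
      exact_mod_cast Finset.card_le_card (fun z hz => by
        rw [mem_filter] at hz ⊢
        exact ⟨mem_univ _, ringWinU_ow_eq_false_of_hit hiL c y hcf u z hz.2⟩)
    -- double counting over the fibres
    have hcount : (2 : ℝ) ^ L * ((univ.filter fun u : Fin n → Bool => ringWinU c y u = false).card : ℝ) =
        ∑ u : Fin n → Bool,
          ((univ.filter fun z : Fin L → Bool => ringWinU c y (ow i L u z) = false).card : ℝ) := by
      have h := sum_fibre hiL (fun u => if ringWinU c y u = false then (1 : ℝ) else 0)
      simp only [Finset.sum_boole] at h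
      exact h
    have hloss : η₀ * (2 : ℝ) ^ n ≤
        ((univ.filter fun u : Fin n → Bool => ringWinU c y u = false).card : ℝ) := by
      have h2L : (0 : ℝ) < (2 : ℝ) ^ L := by positivity
      refine le_of_mul_le_mul_left ?_ h2L
      rw [hcount]
      calc (2 : ℝ) ^ L * (η₀ * (2 : ℝ) ^ n) = ∑ _u : Fin n → Bool, η₀ * (2 : ℝ) ^ L := by
            rw [Finset.sum_const, Finset.card_univ, Fintype.card_fun, Fintype.card_bool, Fintype.card_fin,
              nsmul_eq_mul]
            push_cast
            ring
        _ ≤ _ := Finset.sum_le_sum fun u _ => hfibre u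
    calc ((univ.filter fun u : Fin n → Bool => ringWinU c y u = true).card : ℝ)
        ≤ (1 - η₀) * (2 : ℝ) ^ n := by linarith
      _ ≤ max (1 - η₀) (1 / 2) * (2 : ℝ) ^ n := mul_le_mul_of_nonneg_right hθ h2n.le


/-- **R4 from level-set elimination**: `hE → WalkHardFSparse p` (via `sparseOfGap`). -/
theorem walkHardFSparse_of_elimLevel (p : ℕ) [Fact p.Prime]
    (hE : ∃ η₀ : ℝ, 0 < η₀ ∧ ∃ c₀ : ℝ, 0 < c₀ ∧ ∃ n₀ : ℕ, ∀ n ≥ n₀, ∀ d : ℕ, (d : ℝ) ≤ c₀ * Real.sqrt n →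
      ∀ e : (Fin n → Bool) → ℕ,
        (∀ r : ℕ, (fun u => if e u % 3 = r % 3 then (1 : ZMod p) else 0) ∈
          Smolensky.lowDeg (ZMod p) n d) →
        η₀ * (2 : ℝ) ^ n ≤ ((Finset.univ.filter fun u : Fin n → Bool =>
          e u % 3 = Hegedus.wt u % 3).card : ℝ)) :
    WalkHardFSparse p :=
  sparseOfGap p (walkHardFGap_of_elimLevel p hE)

/-- **Rung R3 `WalkHardFGap p` — PROVED for every prime `p ≠ 3`** (the fibre argument over qn-prover g10's
level-set elimination theorem `elimLevelSqrtF`). -/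
theorem walkHardFGap (p : ℕ) [Fact p.Prime] (hp3 : p ≠ 3) : WalkHardFGap p :=
  walkHardFGap_of_elimLevel p (elimLevelSqrtF p hp3)

/-- **Rung R4 `WalkHardFSparse p` — PROVED for every prime `p ≠ 3`**: strategies of `𝔽_p`-degree `(log₂ n)^C` with
`s` potentially-active cuts, `s³·(log₂ n)^{2C+3} ≤ n`, ANY geometry, win α's u-walk game on at most `θ·2ⁿ` inputs, one
`θ < 1` for all `C` (R3 on the longest cut-free interval, `sparseOfGap`). -/
theorem walkHardFSparse (p : ℕ) [Fact p.Prime] (hp3 : p ≠ 3) : WalkHardFSparse p :=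
  sparseOfGap p (walkHardFGap p hp3)

end Summit.QuantumAdvantage.AdviceFreeQNC0

end
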